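/-
Copyright: lit-balaban Phase-2 proof seat p29 (gen 30).  Statement-level skeleton of a published paper; no proof claims beyond what the
kernel checks below.
-/
import Literature.MathematicalPhysics.QuantumFieldTheory.BalabanImbrieJaffe1984to88.BIJ88Loc231SmallPlaquetteRegion
import Literature.MathematicalPhysics.QuantumFieldTheory.BalabanImbrieJaffe1984to88.BIJ88NeumannPropagatorActualBackground

/-!
# `BalabanImbrieJaffe1984to88.BIJ88Loc231ActualBackground` — T. Bałaban, J. Imbrie, A. Jaffe, *Effective action and cluster properties of the
abelian Higgs model*, Commun. Math. Phys. **114** (1988) 257–315 [BalabanImbrieJaffe1988], Sect. 2 p. 263 [PDF 7], (2.31) and the sentence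
after (2.33) — **THE COVARIANT-DERIVATIVE ANALOGUE AND THE HÖLDER-`θ ≤ 1` MEMBER OF (2.31), FOR EVERY `k`-BLOCK UNION `Ω ⊇ Ω₀` AND THE PRINTED
TORUS DATA OF RECORD, AT THE ACTUAL BACKGROUND `u_k` OF THE INDUCTION** ([BalabanImbrieJaffe1985] (4.5.4); p. 326: *"The propagators arising
from Δ_k(u_k), under the restriction (7.3.1) on the gauge field, also satisfy the regularity and decay estimates of [7]"*): this gen's
hypothesis-free small-plaquette region members `BIJ88Loc231SmallPlaquetteRegion.{deriv231, holder231, exists_contour_holder231}_smallPlaquette_region`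
at the field `u_k = actualBgU1 hd2 k e v` (p30's (4.5.4) background of record) under the PRINTED (7.3.1) `‖v(∂q) − 1‖ ≤ e𝓅(e)` on all unit
plaquettes and `e𝓅(e) ≤ 1/(23D²K)`, by p34 gen 19's passage `smallPlaquette_actualBg` (θ = K·e𝓅(e)/(L^k)², `K = K(D, L) ≥ 1` from p33's all-tori
constant), consumed BY NAME exactly as offered (p34 gen 19 → p29, 2026-08-23T08:34Z).

statement-level skeleton of published theorems with citation tags; proofs where landed; nothing here is a claim about the Yang–Mills mass gap

PDF held: `paper:balaban1988-cmp114-bij-abelian-higgs-effective-action` (journal page = PDF page + 256); p. 263 [PDF 7] re-read this session.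

CITATION HEADER (lean-in-tree rule).  Part of the lit-balaban TYPED SKELETON (HOME `run/shared/lean/pub/lit-balaban/`), PHASE-2 proof seat
p29 gen 30 (unit `lit-balaban-p29-g30`; TAKING #7 line HOME/STATUS.md 2026-08-23T09:02Z; free-target protocol G.5-34(d)).  Rows **C2.Eq2.31**
/ **C2.Claim@263** (owner r18; heads unchanged — LOCATED member at `u_k`) and **C1.Eq7.3.1-7.3.2** / **C1.Eq4.5.4** (owner r15: located
consequence).  Kind: theorems only (no definition, no `Prop`-valued fact; p29/p30/p34 declarations BY NAME).

THE PRINTED TEXT (p. 263, verbatim, print order).  *"|(G_{k,loc}(u)f − G_k(Ω,u)f)(x)| ≦ e^{−cr(e_k)}e^{−c dist(suppt f,x)}‖f‖_∞, (2.31) for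
dist(x, Ω^c) ≧ O(r(e_k)). … for (2.31) we assume smoothness throughout the subset Ω ⊂ T_η. … Bounds analogous to (2.30), (2.31) hold for
covariant derivatives and Hölder derivatives of G_{k,loc}(u) of order less than two."*  [BalabanImbrieJaffe1985] p. 326: *"(7.3.1)
|v(∂p) − 1| < e𝓅(e) … The propagators arising from Δ_k(u_k), under the restriction (7.3.1) on the gauge field, also satisfy the regularity and
decay estimates of [7]."*

WHAT IS PROVED (theorems only; 0 `sorry`; standard axioms).  For `1 ≤ d`, `d + 1 ≤ 3`, `ℓ ≥ 1`, `ℓ + 1` odd, `a > 0`, `pexp`: THERE ARE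
`K ≥ 1`, `δ₀, C > 0` such that on every torus (`P.d = d+1`, `P.L = ℓ+1`), at every `1 ≤ k ≤ K_P` with `2(L^k−1) + 4 < |T^{(0)}|`, for every
`0 < e ≤ 1` with `e(1 + log e⁻¹)^{pexp} ≤ 1/(23(d+1)²K)`, every unit-lattice `U(1)` field `v` with `‖v(∂q) − 1‖ ≤ e(1 + log e⁻¹)^{pexp}` on all
plaquettes, every union `Ω` of `k`-blocks containing `Ω₀`, the printed data (`R > L^k + 1`):
* **`deriv231_actualBg_region`** — `‖D_{u_k}(G_{k,loc}(u_k)f)(x,μ) − D_{u_k}(G_k(Ω,u_k)f)(x,μ)‖ ≤ (L^kε)·C·[m(1 + L^k((R₀−R₁)⁻¹ + s⁻¹))e^{−δ₀(2R−1)/L^k} +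
  (1 + L^k(R₀−R₁)⁻¹)e^{−(δ₀/2)(R₁−1)/L^k}]·e^{−(δ₀/2)D/L^k}·F` at every deep bond;
* **`holder231_actualBg_region`** / **`exists_contour_holder231_actualBg_region`** — the Hölder-`θ' ≤ 1` member along admissible contours / the
  chart staircase.
HONEST SCOPE / DIVERGENCE.  (i) As `BIJ88Loc231SmallPlaquetteRegion` (dimensions `2 ≤ d + 1 ≤ 3`, `L` odd `≥ 3`, block unions, deep bonds,
method divergence of the providers).  (ii) `u_k = actualBgU1 hd2 k e v` is the tree's (4.5.4) background object of p30/p34's lineage (centred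
block conventions); its relation to every printed convention is discussed in their files, not here.  (iii) *"e sufficiently small"* = the ONE
explicit threshold `e𝓅(e) ≤ 1/(23D²K)` with p33's all-tori `K` (not evaluated).  (iv) `Ω = T^{(0)}` is the block union `univ`.  Imports: this
gen's `BIJ88Loc231SmallPlaquetteRegion`, p34 gen 19's `BIJ88NeumannPropagatorActualBackground`.  Literature + Mathlib only.  Unit
`lit-balaban-p29` (literature-prover-lit-balaban-p29-g30-0), 2026-08-23.  NOT summit progress.
-/

open scoped BigOperators Matrix ComplexConjugate
open Finset Matrix

namespace Literature.MathematicalPhysics.QuantumFieldTheory.BalabanImbrieJaffe1984to88.BIJ88Loc231ActualBackground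

open Literature.MathematicalPhysics.QuantumFieldTheory.Balaban1983to89
open BIJ88Sect3Statements (U1 toC cfg covD)
open BIJ85BlockAveragesTorus BIJ85BlockAveragesTorusK
open BIJ88NeumannPropagator227Torus (gBox)
open BIJ88DeltaLoc234Torus (gLocT)
open BIJ88NeumannPropagatorFlatDecayCube (cubeT boxCoord)
open BIJ88Cutoffs21 (cutoff)
open BIJ88LocWeights227Torus
open BIJ85Sect1Model (U1Field plaq)
open BIJ85Eq454PlaqResidual (actualBgU1)
open BIJ88NeumannNoZeroModesTorus (IsBlockUnion)
open BIJ88NeumannPropagatorActualBackground (smallPlaquette_actualBg)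
open BIJ88Loc231SmallPlaquetteRegion (deriv231_smallPlaquette_region holder231_smallPlaquette_region
  exists_contour_holder231_smallPlaquette_region)
open T4TreeGaugeFixing (Joins)
open T4TreeGaugeTransform (chainHol)

noncomputable section

variable {d : ℕ} {P : Params}

set_option maxHeartbeats 400000 in
/-- **THE COVARIANT-DERIVATIVE ANALOGUE OF (2.31) FOR A `k`-BLOCK REGION `Ω ⊇ Ω₀` AT THE ACTUAL BACKGROUND `u_k` UNDER (7.3.1)**
(p. 263 (2.31) + *"Bounds analogous to (2.30), (2.31) hold for covariant derivatives …"*; [BalabanImbrieJaffe1985] (4.5.4), (7.3.1)):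
`deriv231_smallPlaquette_region` at `u = actualBgU1 hd2 k e v`, `θ = K·e𝓅(e)/(L^k)²` (p34's `smallPlaquette_actualBg`).
[cite: BalabanImbrieJaffe1988, (2.31) p.263] [cite: BalabanImbrieJaffe1985, (7.3.1) p.326, (4.5.4) p.313] -/
theorem deriv231_actualBg_region (d ℓ : ℕ) (hd1 : 1 ≤ d) (hd3 : d + 1 ≤ 3) (hℓ : 1 ≤ ℓ) (hodd : Odd (ℓ + 1)) {a : ℝ} (ha : 0 < a)
    (pexp : ℝ) :
    ∃ K δ₀ C : ℝ, 1 ≤ K ∧ 0 < δ₀ ∧ 0 < C ∧ ∀ (P : Params) (hPd : P.d = d + 1), P.L = ℓ + 1 →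
      ∀ (hd2 : 2 ≤ P.d) (k : ℕ), 1 ≤ k → k ≤ P.K → 2 * (P.L ^ k - 1) + 4 < P.sitesPerDir 0 →
      ∀ (e : ℝ), 0 < e → e ≤ 1 → e * (1 + Real.log e⁻¹) ^ pexp ≤ 1 / (23 * (P.d : ℝ) ^ 2 * K) →
      ∀ (v : U1Field P k), (∀ q : Balaban1983to89.Plaq P k, ‖((plaq v q : Circle) : ℂ) - 1‖ ≤ e * (1 + Real.log e⁻¹) ^ pexp) →
      ∀ (Ω : Finset (Balaban1983to89.Site P 0)), IsBlockUnion k Ω →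
      ∀ (c M0 : Fin (d + 1) → ℕ), (∀ i, 1 ≤ M0 i) →
        (∀ i, c i * P.L ^ k + P.L ^ k * M0 i ≤ P.sitesPerDir 0) → (∀ i, P.L ^ k * M0 i < P.sitesPerDir 0) →
        (cubeT hPd (P.L ^ k) c fun i => P.L ^ k * M0 i) ⊆ Ω →
      ∀ (s W : ℕ), 1 ≤ s → ∀ (R R₀ R₁ : ℝ), (P.L : ℝ) ^ k + 1 < R → 0 ≤ R₁ → R₁ < R₀ → 2 * (s : ℝ) / 3 + R₀ / 2 + R ≤ W →
        (∀ i, ((P.L ^ k * M0 i : ℕ) : ℝ) + R ≤ P.sitesPerDir 0) →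
      ∀ (x : Balaban1983to89.Site P 0) (μ : Fin P.d),
        x ∈ (cubeT hPd (P.L ^ k) c fun i => P.L ^ k * M0 i) →
        (∀ i, R₀ + R ≤ (boxCoord hPd (P.L ^ k) c x i : ℝ) ∧ (boxCoord hPd (P.L ^ k) c x i : ℝ) + (R₀ + R) ≤ (P.L ^ k * M0 i : ℕ) - 1) →
        x.shift μ ∈ (cubeT hPd (P.L ^ k) c fun i => P.L ^ k * M0 i) →
        (∀ i, R₀ + R ≤ (boxCoord hPd (P.L ^ k) c (x.shift μ) i : ℝ) ∧
          (boxCoord hPd (P.L ^ k) c (x.shift μ) i : ℝ) + (R₀ + R) ≤ (P.L ^ k * M0 i : ℕ) - 1) →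
      ∀ (f : Balaban1983to89.Site P 0 → ℂ) (F D : ℝ), (∀ y, ‖f y‖ ≤ F) → 0 ≤ D → (∀ y, f y ≠ 0 → D ≤ B5Ineq137Torus.T P 0 x y) →
        ‖covD P.eps⁻¹ (cfg (actualBgU1 hd2 k e v))
              (gLocT (B1RG242Torus.α P a k * (P.L : ℝ) ^ (k * P.d)) P.eps⁻¹ (actualBgU1 hd2 k e v) k
                (cubeFam hPd (P.L ^ k) c M0 s W) (lamFam hPd (P.L ^ k) c M0 s) (cutoff R₁ R₀ (B5Ineq137Torus.T P 0)) *ᵥ f) ⟨x, μ⟩ -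
            covD P.eps⁻¹ (cfg (actualBgU1 hd2 k e v)) (gBox (B1RG242Torus.α P a k * (P.L : ℝ) ^ (k * P.d)) P.eps⁻¹ (actualBgU1 hd2 k e v) k Ω *ᵥ f) ⟨x, μ⟩‖ ≤
          P.spacing k * (C * ((⌊(((P.L : ℝ) ^ k) - 1 + R₀) / s⌋₊ + 3) ^ (d + 1) * (1 + (P.L : ℝ) ^ k * ((R₀ - R₁)⁻¹ + (s : ℝ)⁻¹)) *
              Real.exp (-(δ₀ * (((P.L : ℝ) ^ k)⁻¹ * (2 * R - 1)))) +
            (1 + (P.L : ℝ) ^ k * (R₀ - R₁)⁻¹) * Real.exp (-(δ₀ / 2 * (((P.L : ℝ) ^ k)⁻¹ * (R₁ - 1))))) *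
            Real.exp (-(δ₀ / 2 * (((P.L : ℝ) ^ k)⁻¹ * D))) * F) := by
  obtain ⟨K, hK1, HK⟩ := smallPlaquette_actualBg (d := d + 1) (L := ℓ + 1) (by omega) pexp
  obtain ⟨δ₀, C, hδ₀, hC, G⟩ := deriv231_smallPlaquette_region d ℓ hd1 hd3 hℓ hodd ha
  refine ⟨K, δ₀, C, hK1, hδ₀, hC, ?_⟩
  intro P hPd hPL hd2 k hk1 hkK hbig e he he1 hsm v hv Ω hΩbu c M0 hM0 hfit0 hN0 hΩ s W hs R R₀ R₁ hR hR₁ hR10 hW hgap x μ hx hdeep hxe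
    hdeepe f F D hF hD hsupp
  have hk : k ≤ P.m + P.K := hkK.trans (Nat.le_add_left _ _)
  obtain ⟨hθ0, hplaqC, -, -, -, -, hτ⟩ := HK P hPd hPL hd2 k hk1 hk e he he1 hsm v hv
  exact G P hPd hPL k hk1 hkK hbig (actualBgU1 hd2 k e v) _ hθ0 hplaqC hτ Ω hΩbu c M0 hM0 hfit0 hN0 hΩ s W hs R R₀ R₁ hR hR₁ hR10 hW hgap x μ hx
    hdeep hxe hdeepe f F D hF hD hsupp

set_option maxHeartbeats 400000 in
/-- **THE HÖLDER MEMBER OF ORDER `θ' ≤ 1` OF (2.31) FOR A `k`-BLOCK REGION `Ω ⊇ Ω₀` AT THE ACTUAL BACKGROUND `u_k` UNDER (7.3.1), ALONG EVERY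
ADMISSIBLE CONTOUR** (p. 263: *"… Hölder derivatives of G_{k,loc}(u) of order less than two"*): `holder231_smallPlaquette_region` at
`u = actualBgU1 hd2 k e v`. [cite: BalabanImbrieJaffe1988, (2.31) p.263] [cite: BalabanImbrieJaffe1985, (7.3.1) p.326, (4.5.4) p.313] -/
theorem holder231_actualBg_region (d ℓ : ℕ) (hd1 : 1 ≤ d) (hd3 : d + 1 ≤ 3) (hℓ : 1 ≤ ℓ) (hodd : Odd (ℓ + 1)) {a : ℝ} (ha : 0 < a)
    (pexp : ℝ) :
    ∃ K δ₀ C : ℝ, 1 ≤ K ∧ 0 < δ₀ ∧ 0 < C ∧ ∀ (P : Params) (hPd : P.d = d + 1), P.L = ℓ + 1 →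
      ∀ (hd2 : 2 ≤ P.d) (k : ℕ), 1 ≤ k → k ≤ P.K → 2 * (P.L ^ k - 1) + 4 < P.sitesPerDir 0 →
      ∀ (e : ℝ), 0 < e → e ≤ 1 → e * (1 + Real.log e⁻¹) ^ pexp ≤ 1 / (23 * (P.d : ℝ) ^ 2 * K) →
      ∀ (v : U1Field P k), (∀ q : Balaban1983to89.Plaq P k, ‖((plaq v q : Circle) : ℂ) - 1‖ ≤ e * (1 + Real.log e⁻¹) ^ pexp) →
      ∀ (Ω : Finset (Balaban1983to89.Site P 0)), IsBlockUnion k Ω →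
      ∀ (c M0 : Fin (d + 1) → ℕ), (∀ i, 1 ≤ M0 i) →
        (∀ i, c i * P.L ^ k + P.L ^ k * M0 i ≤ P.sitesPerDir 0) → (∀ i, P.L ^ k * M0 i < P.sitesPerDir 0) →
        (cubeT hPd (P.L ^ k) c fun i => P.L ^ k * M0 i) ⊆ Ω →
      ∀ (s W : ℕ), 1 ≤ s → ∀ (R R₀ R₁ : ℝ), (P.L : ℝ) ^ k + 1 < R → 0 ≤ R₁ → R₁ < R₀ → 2 * (s : ℝ) / 3 + R₀ / 2 + R ≤ W →
        (∀ i, ((P.L ^ k * M0 i : ℕ) : ℝ) + R ≤ P.sitesPerDir 0) →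
      ∀ (θ' : ℝ), 0 ≤ θ' → θ' ≤ 1 →
      ∀ (x₁ x₂ : Balaban1983to89.Site P 0) (n : ℕ) (sq : ℕ → Balaban1983to89.Site P 0) (cb : ℕ → PBond P 0),
        sq 0 = x₁ → sq n = x₂ → (∀ m < n, Joins (cb m) (sq m) (sq (m + 1))) →
        (n : ℝ) ≤ ((d : ℝ) + 1) * B5Ineq137Torus.T P 0 x₁ x₂ →
        (∀ m ≤ n, sq m ∈ (cubeT hPd (P.L ^ k) c fun i => P.L ^ k * M0 i) ∧
          (∀ i, R₀ + R ≤ (boxCoord hPd (P.L ^ k) c (sq m) i : ℝ) ∧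
            (boxCoord hPd (P.L ^ k) c (sq m) i : ℝ) + (R₀ + R) ≤ (P.L ^ k * M0 i : ℕ) - 1) ∧
          B5Ineq137Torus.T P 0 x₁ (sq m) ≤ B5Ineq137Torus.T P 0 x₁ x₂) →
      ∀ (f : Balaban1983to89.Site P 0 → ℂ) (F D : ℝ), (∀ y, ‖f y‖ ≤ F) → 0 ≤ D →
        (∀ y, f y ≠ 0 → D ≤ B5Ineq137Torus.T P 0 x₁ y) → (∀ y, f y ≠ 0 → D ≤ B5Ineq137Torus.T P 0 x₂ y) →
        ((P.L : ℝ) ^ k / B5Ineq137Torus.T P 0 x₁ x₂) ^ θ' *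
          ‖toC (chainHol sq cb (actualBgU1 hd2 k e v) n) *
              ((gLocT (B1RG242Torus.α P a k * (P.L : ℝ) ^ (k * P.d)) P.eps⁻¹ (actualBgU1 hd2 k e v) k
                  (cubeFam hPd (P.L ^ k) c M0 s W) (lamFam hPd (P.L ^ k) c M0 s) (cutoff R₁ R₀ (B5Ineq137Torus.T P 0)) *ᵥ f) x₂ -
                (gBox (B1RG242Torus.α P a k * (P.L : ℝ) ^ (k * P.d)) P.eps⁻¹ (actualBgU1 hd2 k e v) k Ω *ᵥ f) x₂) -
            ((gLocT (B1RG242Torus.α P a k * (P.L : ℝ) ^ (k * P.d)) P.eps⁻¹ (actualBgU1 hd2 k e v) k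
                  (cubeFam hPd (P.L ^ k) c M0 s W) (lamFam hPd (P.L ^ k) c M0 s) (cutoff R₁ R₀ (B5Ineq137Torus.T P 0)) *ᵥ f) x₁ -
                (gBox (B1RG242Torus.α P a k * (P.L : ℝ) ^ (k * P.d)) P.eps⁻¹ (actualBgU1 hd2 k e v) k Ω *ᵥ f) x₁)‖ ≤
          P.spacing k ^ 2 * (C * Real.exp (δ₀ / 2) *
            ((⌊(((P.L : ℝ) ^ k) - 1 + R₀) / s⌋₊ + 3) ^ (d + 1) * (1 + (P.L : ℝ) ^ k * ((R₀ - R₁)⁻¹ + (s : ℝ)⁻¹)) *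
              Real.exp (-(δ₀ * (((P.L : ℝ) ^ k)⁻¹ * (2 * R - 1)))) +
            (1 + (P.L : ℝ) ^ k * (R₀ - R₁)⁻¹) * Real.exp (-(δ₀ / 2 * (((P.L : ℝ) ^ k)⁻¹ * (R₁ - 1))))) *
            Real.exp (-(δ₀ / 2 * (((P.L : ℝ) ^ k)⁻¹ * D))) * F) := by
  obtain ⟨K, hK1, HK⟩ := smallPlaquette_actualBg (d := d + 1) (L := ℓ + 1) (by omega) pexp
  obtain ⟨δ₀, C, hδ₀, hC, G⟩ := holder231_smallPlaquette_region d ℓ hd1 hd3 hℓ hodd ha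
  refine ⟨K, δ₀, C, hK1, hδ₀, hC, ?_⟩
  intro P hPd hPL hd2 k hk1 hkK hbig e he he1 hsm v hv Ω hΩbu c M0 hM0 hfit0 hN0 hΩ s W hs R R₀ R₁ hR hR₁ hR10 hW hgap θ' hθ'0 hθ'1 x₁ x₂ n sq cb
    hsq0 hsqn hJ hnle hchain f F D hF hD hsupp₁ hsupp₂
  have hk : k ≤ P.m + P.K := hkK.trans (Nat.le_add_left _ _)
  obtain ⟨hθ0, hplaqC, -, -, -, -, hτ⟩ := HK P hPd hPL hd2 k hk1 hk e he he1 hsm v hv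
  exact G P hPd hPL k hk1 hkK hbig (actualBgU1 hd2 k e v) _ hθ0 hplaqC hτ Ω hΩbu c M0 hM0 hfit0 hN0 hΩ s W hs R R₀ R₁ hR hR₁ hR10 hW hgap
    θ' hθ'0 hθ'1 x₁ x₂ n sq cb hsq0 hsqn hJ hnle hchain f F D hF hD hsupp₁ hsupp₂

/-- **THE SAME ALONG THE CHART STAIRCASE** at the actual background: `exists_contour_holder231_smallPlaquette_region` at
`u = actualBgU1 hd2 k e v`. [cite: BalabanImbrieJaffe1988, (2.31) p.263] [cite: BalabanImbrieJaffe1985, (7.3.1) p.326, (4.5.4) p.313] -/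
theorem exists_contour_holder231_actualBg_region (d ℓ : ℕ) (hd1 : 1 ≤ d) (hd3 : d + 1 ≤ 3) (hℓ : 1 ≤ ℓ) (hodd : Odd (ℓ + 1)) {a : ℝ}
    (ha : 0 < a) (pexp : ℝ) :
    ∃ K δ₀ C : ℝ, 1 ≤ K ∧ 0 < δ₀ ∧ 0 < C ∧ ∀ (P : Params) (hPd : P.d = d + 1), P.L = ℓ + 1 →
      ∀ (hd2 : 2 ≤ P.d) (k : ℕ), 1 ≤ k → k ≤ P.K → 2 * (P.L ^ k - 1) + 4 < P.sitesPerDir 0 →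
      ∀ (e : ℝ), 0 < e → e ≤ 1 → e * (1 + Real.log e⁻¹) ^ pexp ≤ 1 / (23 * (P.d : ℝ) ^ 2 * K) →
      ∀ (v : U1Field P k), (∀ q : Balaban1983to89.Plaq P k, ‖((plaq v q : Circle) : ℂ) - 1‖ ≤ e * (1 + Real.log e⁻¹) ^ pexp) →
      ∀ (Ω : Finset (Balaban1983to89.Site P 0)), IsBlockUnion k Ω →
      ∀ (c M0 : Fin (d + 1) → ℕ), (∀ i, 1 ≤ M0 i) →
        (∀ i, c i * P.L ^ k + P.L ^ k * M0 i ≤ P.sitesPerDir 0) → (∀ i, P.L ^ k * M0 i < P.sitesPerDir 0) →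
        (cubeT hPd (P.L ^ k) c fun i => P.L ^ k * M0 i) ⊆ Ω →
      ∀ (s W : ℕ), 1 ≤ s → ∀ (R R₀ R₁ : ℝ), (P.L : ℝ) ^ k + 1 < R → 0 ≤ R₁ → R₁ < R₀ → 2 * (s : ℝ) / 3 + R₀ / 2 + R ≤ W →
        (∀ i, ((P.L ^ k * M0 i : ℕ) : ℝ) + R ≤ P.sitesPerDir 0) →
      ∀ (x₁ x₂ : Balaban1983to89.Site P 0),
        x₁ ∈ (cubeT hPd (P.L ^ k) c fun i => P.L ^ k * M0 i) →
        (∀ i, R₀ + R ≤ (boxCoord hPd (P.L ^ k) c x₁ i : ℝ) ∧ (boxCoord hPd (P.L ^ k) c x₁ i : ℝ) + (R₀ + R) ≤ (P.L ^ k * M0 i : ℕ) - 1) →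
        x₂ ∈ (cubeT hPd (P.L ^ k) c fun i => P.L ^ k * M0 i) →
        (∀ i, R₀ + R ≤ (boxCoord hPd (P.L ^ k) c x₂ i : ℝ) ∧ (boxCoord hPd (P.L ^ k) c x₂ i : ℝ) + (R₀ + R) ≤ (P.L ^ k * M0 i : ℕ) - 1) →
        B5Ineq137Torus.T P 0 x₁ x₂ ≤ R₀ + R →
      ∃ (N : ℕ) (sq : ℕ → Balaban1983to89.Site P 0) (cb : ℕ → PBond P 0), sq 0 = x₁ ∧ sq N = x₂ ∧
        (∀ m < N, Joins (cb m) (sq m) (sq (m + 1))) ∧ (N : ℝ) ≤ ((d : ℝ) + 1) * B5Ineq137Torus.T P 0 x₁ x₂ ∧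
      ∀ (θ' : ℝ), 0 ≤ θ' → θ' ≤ 1 →
      ∀ (f : Balaban1983to89.Site P 0 → ℂ) (F D : ℝ), (∀ y, ‖f y‖ ≤ F) → 0 ≤ D →
        (∀ y, f y ≠ 0 → D ≤ B5Ineq137Torus.T P 0 x₁ y) → (∀ y, f y ≠ 0 → D ≤ B5Ineq137Torus.T P 0 x₂ y) →
        ((P.L : ℝ) ^ k / B5Ineq137Torus.T P 0 x₁ x₂) ^ θ' *
          ‖toC (chainHol sq cb (actualBgU1 hd2 k e v) N) *
              ((gLocT (B1RG242Torus.α P a k * (P.L : ℝ) ^ (k * P.d)) P.eps⁻¹ (actualBgU1 hd2 k e v) k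
                  (cubeFam hPd (P.L ^ k) c M0 s W) (lamFam hPd (P.L ^ k) c M0 s) (cutoff R₁ R₀ (B5Ineq137Torus.T P 0)) *ᵥ f) x₂ -
                (gBox (B1RG242Torus.α P a k * (P.L : ℝ) ^ (k * P.d)) P.eps⁻¹ (actualBgU1 hd2 k e v) k Ω *ᵥ f) x₂) -
            ((gLocT (B1RG242Torus.α P a k * (P.L : ℝ) ^ (k * P.d)) P.eps⁻¹ (actualBgU1 hd2 k e v) k
                  (cubeFam hPd (P.L ^ k) c M0 s W) (lamFam hPd (P.L ^ k) c M0 s) (cutoff R₁ R₀ (B5Ineq137Torus.T P 0)) *ᵥ f) x₁ -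
                (gBox (B1RG242Torus.α P a k * (P.L : ℝ) ^ (k * P.d)) P.eps⁻¹ (actualBgU1 hd2 k e v) k Ω *ᵥ f) x₁)‖ ≤
          P.spacing k ^ 2 * (C * Real.exp (δ₀ / 2) *
            ((⌊(((P.L : ℝ) ^ k) - 1 + R₀) / s⌋₊ + 3) ^ (d + 1) * (1 + (P.L : ℝ) ^ k * ((R₀ - R₁)⁻¹ + (s : ℝ)⁻¹)) *
              Real.exp (-(δ₀ * (((P.L : ℝ) ^ k)⁻¹ * (2 * R - 1)))) +
            (1 + (P.L : ℝ) ^ k * (R₀ - R₁)⁻¹) * Real.exp (-(δ₀ / 2 * (((P.L : ℝ) ^ k)⁻¹ * (R₁ - 1))))) *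
            Real.exp (-(δ₀ / 2 * (((P.L : ℝ) ^ k)⁻¹ * D))) * F) := by
  obtain ⟨K, hK1, HK⟩ := smallPlaquette_actualBg (d := d + 1) (L := ℓ + 1) (by omega) pexp
  obtain ⟨δ₀, C, hδ₀, hC, G⟩ := exists_contour_holder231_smallPlaquette_region d ℓ hd1 hd3 hℓ hodd ha
  refine ⟨K, δ₀, C, hK1, hδ₀, hC, ?_⟩
  intro P hPd hPL hd2 k hk1 hkK hbig e he he1 hsm v hv Ω hΩbu c M0 hM0 hfit0 hN0 hΩ s W hs R R₀ R₁ hR hR₁ hR10 hW hgap x₁ x₂ hx₁ hdeep₁ hx₂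
    hdeep₂ hT
  have hk : k ≤ P.m + P.K := hkK.trans (Nat.le_add_left _ _)
  obtain ⟨hθ0, hplaqC, -, -, -, -, hτ⟩ := HK P hPd hPL hd2 k hk1 hk e he he1 hsm v hv
  exact G P hPd hPL k hk1 hkK hbig (actualBgU1 hd2 k e v) _ hθ0 hplaqC hτ Ω hΩbu c M0 hM0 hfit0 hN0 hΩ s W hs R R₀ R₁ hR hR₁ hR10 hW hgap x₁ x₂
    hx₁ hdeep₁ hx₂ hdeep₂ hT

end

end Literature.MathematicalPhysics.QuantumFieldTheory.BalabanImbrieJaffe1984to88.BIJ88Loc231ActualBackground
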